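import Mathlib

/-!
# Double count over the cyclic translates of a pattern (`stub_patternCount`)

A *letter* is `l : Fin 3 × Fin 3 × ℂ × Option (Fin n × Fin n)`; `l.2.2.2 = some v` means the
letter reads the variable `x_v`, `v = (row, col)`, and `l.2.2.2 = none` is a constant letter.
For a pattern `S ⊆ Fin n × Fin n` and a translate `g : Fin n × Fin n`, the letter is an
`(S + g)`-letter when `(v.1 - g.1, v.2 - g.2) ∈ S` (subtraction in the additive group `Fin n`,
available since `NeZero n`).  Summed over all `n²` translates `g`, every variable letter is counted
exactly `|S|` times — the reflection `g ↦ (v.1 - g.1, v.2 - g.2)` is an involution of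
`Fin n × Fin n`, so the translates counting the letter form the image of `S` under it — and a
constant letter is never counted.  Hence the translate counts of a word total `|S|` times the
number of its variable letters.
-/

set_option linter.dupNamespace false

namespace Summit.ValiantsHypothesis.ValiantsHypothesis.Theorems.WordPerSuperQuartic

/-- The reflection `g ↦ (v.1 - g.1, v.2 - g.2)` of `Fin n × Fin n` is an involution. -/
private theorem patternCount_reflect_involutive (n : ℕ) [NeZero n] (v : Fin n × Fin n) :
    Function.Involutive (fun g : Fin n × Fin n => (v.1 - g.1, v.2 - g.2)) := by
  intro g
  simp [sub_sub_cancel]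

/-- A single letter is counted by exactly `|S|` translates if it reads a variable, and by no
translate if it is constant. -/
private theorem patternCount_letter (n : ℕ) [NeZero n] (S : Finset (Fin n × Fin n))
    (l : Fin 3 × Fin 3 × ℂ × Option (Fin n × Fin n)) :
    ∑ g : Fin n × Fin n,
      (if l.2.2.2.any (fun v => decide ((v.1 - g.1, v.2 - g.2) ∈ S)) = true then 1 else 0) =
      S.card * (if l.2.2.2.isSome = true then 1 else 0) := by
  obtain ⟨i, j, z, _ | v⟩ := l
  · simp
  · simp only [Option.any_some, decide_eq_true_eq, Option.isSome_some, if_true, mul_one]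
    rw [Finset.sum_boole, Nat.cast_id]
    have hinv := patternCount_reflect_involutive n v
    have hS : (Finset.univ.filter (fun g : Fin n × Fin n => (v.1 - g.1, v.2 - g.2) ∈ S)) =
        S.image (fun s : Fin n × Fin n => (v.1 - s.1, v.2 - s.2)) := by
      ext g
      simp only [Finset.mem_filter, Finset.mem_univ, true_and, Finset.mem_image]
      constructor
      · intro hg
        exact ⟨(v.1 - g.1, v.2 - g.2), hg, hinv g⟩
      · rintro ⟨s, hs, rfl⟩
        simpa [sub_sub_cancel] using hs
    rw [hS, Finset.card_image_of_injective _ hinv.injective]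

/-- G2 — **double count over translates**: summed over all `n²` cyclic translates `g` of the
pattern `S`, the number of letters of `w` reading a variable of `S + g` is `|S|` times the number
of variable letters of `w` (every variable letter is counted by exactly `|S|` translates, a
constant letter by none). -/
theorem stub_patternCount (n : ℕ) [NeZero n] (S : Finset (Fin n × Fin n))
    (w : List (Fin 3 × Fin 3 × ℂ × Option (Fin n × Fin n))) :
    ∑ g : Fin n × Fin n,
        w.countP (fun l => l.2.2.2.any (fun v => decide ((v.1 - g.1, v.2 - g.2) ∈ S))) =
      S.card * w.countP (fun l => l.2.2.2.isSome) := by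
  induction w with
  | nil => simp
  | cons l w ih =>
    have hl := patternCount_letter n S l
    simp only [List.countP_cons, Finset.sum_add_distrib, mul_add]
    rw [ih, hl]

end Summit.ValiantsHypothesis.ValiantsHypothesis.Theorems.WordPerSuperQuartic
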